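import Mathlib
import Summits.PneNP.PneNP.Theorems.CnfIdealGenLengthRankDefectRepresentationsStripCompletion

/-!
# Crux `RankDefectRepresentations` (stmt-PneNP-18923), line `rank-dehn-ladder`: the 2D max-cut decomposition is EQUIVALENT to its
# one-coordinate MERGE step (lead g14 RESHAPE 8; memo `Cruxes/RankDefectRepresentations/Lines/rank-dehn-ladder-g14.md`)

`DoubleMaxCutDecomposition K n n' λ` (`Theorems/…TwoFamilyCutDomination`, p653152; registered tool stub
`stub_doubleMaxCutDecomposition` of `Lines/rank_dehn_ladder.lean` asks for `λ = L (n+n'+1)^e`, i.e. a constant POLYNOMIAL IN THE NUMBER OF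
COORDINATES): if every double bipartition cut of a matrix `D` coloured by `{0,1}^n × {0,1}^{n'}` has rank `≤ c`, then
`D = S_I + S_J + L` with `S_I` supported on "first-family colours agree", `S_J` on "second-family colours agree" and `rank L ≤ λ c`.

HALVING ALONG ONE SECOND-FAMILY COORDINATE.  The cells whose row and column second-family colours differ at the last coordinate form an
honest ONE-family instance: as a matrix it is `maskJ row col B₀ D` with `B₀ = {σ : σ_last = false}`, and its first-family bipartition
cuts are literally the double cuts `doubleCut row col B B₀ D ≤ c`, so g7's max-cut decomposition (`exists_blockDiagonal_of_cuts_le`,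
p657204/p642852) removes them at rank `4c`.  What is left, `N := D − maskJ row col B₀ D`, has ZERO cross data and is the direct sum of the two
half-instances `{σ_last = b}` (`b = false, true`), each an instance with `n'` second-family coordinates whose double cuts are sub-blocks of
those of `D` (`doubleCut_half_le`), while the double cuts of `N` itself are at most `2c` (`doubleCut_uncross_le`).  Hence:

* `MergeBound K n n' λ₁` — the MERGE step: «if the cross data at the last second-family coordinate vanish, all double cuts are `≤ c`, and
  each half agrees on its visible cells with a matrix of rank `≤ m`, then the whole decomposes with `rank L ≤ m + λ₁ c`»;
* `doubleMaxCut_of_merge` : `(∀ n', MergeBound K n n' λ₁) → ∀ n', DoubleMaxCutDecomposition K n n' ((4 + 2 λ₁) n')`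
  (induction on `n'`; `n' = 0` is trivial because then all second-family colours agree);
* `merge_of_doubleMaxCut` : `DoubleMaxCutDecomposition K n (n'+1) λ → MergeBound K n n' λ` (the converse, ignoring the halves);
* `doubleMaxCutDecomposition_poly_of_merge` : a MERGE bound polynomial in the number of coordinates gives the registered stub's conclusion
  `∃ L e, ∀ K n n', DoubleMaxCutDecomposition K n n' (L (n+n'+1)^e)` with `e ↦ e + 1`.

So the registered stub is equivalent to the RELATIVE statement MERGE about two already-decomposed halves on the same first-family skeleton
(can the two halves share rank budget through the free first-family-diagonal cross blocks?); CORE-LINEAR (`stub_coreLinear`, absolute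
constant, via `…CoreReduction`) implies MERGE with an absolute `λ₁`, which is more than the SIM recursion (`…SimBoundQuasiPoly`) consumes.
HONEST FRAMING: an elementary reduction inside the negative lane of the crux; MERGE itself stays open; P ≠ NP is not moved; F-N2 is a
FRONTIER formal rung.
-/

set_option linter.dupNamespace false -- `Summit.PneNP.PneNP.…`: summit = sub-problem name (D-0017)

namespace Summit.PneNP.PneNP.Theorems.CnfIdealGenLengthRankDefectRepresentationsMergeReduction

open Matrix Finset
open Summit.PneNP.PneNP.Theorems.CnfIdealGenLengthRankDefectRepresentationsMergeLowerBound (rank_add_le')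
open Summit.PneNP.PneNP.Theorems.CnfIdealGenLengthRankDefectRepresentationsStripCompletion (rank_mask_le)
open Summit.PneNP.PneNP.Theorems.CnfIdealGenLengthRankDefectRepresentationsCutLemmaMonotoneCuts (rank_pad_le)
open Summit.PneNP.PneNP.Theorems.CnfIdealGenLengthRankDefectRepresentationsDoubleMaxCutTwoClasses (exists_blockDiagonal_of_cuts_le)
open Summit.PneNP.PneNP.Theorems.CnfIdealGenLengthRankDefectRepresentationsTwoFamilyCutDomination
  (colourI colourJ maskJ doubleCut DoubleMaxCutDecomposition)

variable {K : Type} [Field K]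

/-! ## The MERGE step -/

/-- **MERGE bound with constant `λ₁` (lead g14 RESHAPE 8).**  For a two-family instance with `n` first-family and `n'+1` second-family
coordinates whose CROSS data at the last second-family coordinate vanish (`D x y = 0` whenever the last second-family bits of `row x` and
`col y` differ), all of whose double bipartition cuts have rank `≤ c`, and each of whose two HALVES `{last bit = b}` agrees on its visible
cells (some first-family coordinate differs and some second-family coordinate differs) with a matrix of rank `≤ m`: the whole instance
decomposes as `D = S_I + S_J + L` (`S_I` supported on "first-family colours agree", `S_J` on "second-family colours agree") with
`rank L ≤ m + λ₁ c`.  Equivalent (for `λ₁` polynomial in `n + n'`) to the registered stub `stub_doubleMaxCutDecomposition`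
(`doubleMaxCut_of_merge`, `merge_of_doubleMaxCut`); implied with an absolute `λ₁` by CORE-LINEAR. [OPEN] -/
def MergeBound (K : Type) [Field K] (n n' lam : ℕ) : Prop :=
  ∀ (ι ι' : Type) [Fintype ι] [Fintype ι'] [DecidableEq ι] [DecidableEq ι']
    (row : ι → Fin n ⊕ Fin (n' + 1) → Bool) (col : ι' → Fin n ⊕ Fin (n' + 1) → Bool) (D : Matrix ι ι' K) (c m : ℕ),
    (∀ B B', doubleCut row col B B' D ≤ c) →
    (∀ x y, row x (Sum.inr (Fin.last n')) ≠ col y (Sum.inr (Fin.last n')) → D x y = 0) →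
    (∀ b : Bool, ∃ L : Matrix ι ι' K, L.rank ≤ m ∧
      ∀ x y, row x (Sum.inr (Fin.last n')) = b → col y (Sum.inr (Fin.last n')) = b →
        (∃ k, row x (Sum.inl k) ≠ col y (Sum.inl k)) → (∃ k', row x (Sum.inr k') ≠ col y (Sum.inr k')) →
        L x y = D x y) →
    ∃ SI SJ : Matrix ι ι' K,
      (∀ x y, (∃ k, row x (Sum.inl k) ≠ col y (Sum.inl k)) → SI x y = 0) ∧
      (∀ x y, (∃ k', row x (Sum.inr k') ≠ col y (Sum.inr k')) → SJ x y = 0) ∧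
      (D - SI - SJ).rank ≤ m + lam * c

/-- The decomposition property is monotone in the constant. -/
theorem doubleMaxCutDecomposition_mono {n n' lam lam' : ℕ} (h : DoubleMaxCutDecomposition K n n' lam) (hle : lam ≤ lam') :
    DoubleMaxCutDecomposition K n n' lam' := by
  intro ι ι' _ _ _ _ row col D c hc
  obtain ⟨SI, SJ, h1, h2, h3⟩ := h ι ι' row col D c hc
  exact ⟨SI, SJ, h1, h2, h3.trans (Nat.mul_le_mul_right c hle)⟩

/-- **The converse direction**: a decomposition bound for `n'+1` second-family coordinates gives the MERGE bound with the same constant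
(the information about the halves is simply not used). -/
theorem merge_of_doubleMaxCut {n n' lam : ℕ} (h : DoubleMaxCutDecomposition K n (n' + 1) lam) : MergeBound K n n' lam := by
  intro ι ι' _ _ _ _ row col D c m hc _ _
  obtain ⟨SI, SJ, h1, h2, h3⟩ := h ι ι' row col D c hc
  exact ⟨SI, SJ, h1, h2, h3.trans (Nat.le_add_left _ _)⟩

/-! ## Tools: the cross matrix, un-crossing, halves -/

section Tools

variable {ι ι' : Type} [Fintype ι] [Fintype ι'] [DecidableEq ι] [DecidableEq ι']

variable {n n' : ℕ} (row : ι → Fin n ⊕ Fin (n' + 1) → Bool) (col : ι' → Fin n ⊕ Fin (n' + 1) → Bool)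

/-- The last second-family bit of a row index. -/
abbrev lastR (x : ι) : Bool := row x (Sum.inr (Fin.last n'))
/-- The last second-family bit of a column index. -/
abbrev lastC (y : ι') : Bool := col y (Sum.inr (Fin.last n'))

/-- The set of second-family colours whose last bit is `false`. -/
def lastFalse (n' : ℕ) : Finset (Fin (n' + 1) → Bool) := Finset.univ.filter fun σ => σ (Fin.last n') = false

omit [Fintype ι] [Fintype ι'] [DecidableEq ι] [DecidableEq ι'] in
/-- The mask of `lastFalse` keeps exactly the CROSS cells (last second-family bits differ). -/
theorem maskJ_lastFalse (D : Matrix ι ι' K) :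
    maskJ row col (lastFalse n') D = Matrix.of fun x y => if lastR row x ≠ lastC col y then D x y else 0 := by
  ext x y
  simp only [maskJ, lastFalse, Matrix.of_apply, Finset.mem_filter, Finset.mem_univ, true_and, colourJ, lastR, lastC]
  rcases Bool.eq_false_or_eq_true (row x (Sum.inr (Fin.last n'))) with h1 | h1 <;>
    rcases Bool.eq_false_or_eq_true (col y (Sum.inr (Fin.last n'))) with h2 | h2 <;> simp [h1, h2]

omit [Fintype ι] [DecidableEq ι] [DecidableEq ι'] in
/-- **The cross matrix is an honest one-family instance**: its first-family bipartition cuts are the double cuts at `B' = lastFalse`. -/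
theorem cross_cuts_le (D : Matrix ι ι' K) (c : ℕ) (hc : ∀ B B', doubleCut row col B B' D ≤ c) (B : Finset (Fin n → Bool)) :
    (Matrix.of fun x y => if colourI (row x) ∈ B ∧ colourI (col y) ∉ B then
        (Matrix.of fun x y => if lastR row x ≠ lastC col y then D x y else (0 : K)) x y else 0).rank +
      (Matrix.of fun x y => if colourI (row x) ∉ B ∧ colourI (col y) ∈ B then
        (Matrix.of fun x y => if lastR row x ≠ lastC col y then D x y else (0 : K)) x y else 0).rank ≤ c := by
  have h := hc B (lastFalse n')
  unfold doubleCut at h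
  rw [maskJ_lastFalse] at h
  exact h

/-- The UN-CROSSED matrix `N`: cross cells zeroed, everything else kept. -/
def uncross (D : Matrix ι ι' K) : Matrix ι ι' K := Matrix.of fun x y => if lastR row x = lastC col y then D x y else 0

omit [Fintype ι] [Fintype ι'] [DecidableEq ι] [DecidableEq ι'] in
/-- Entries of the un-crossed matrix. -/
theorem uncross_apply (D : Matrix ι ι' K) (x : ι) (y : ι') :
    uncross row col D x y = if lastR row x = lastC col y then D x y else 0 := rfl

omit [Fintype ι] [Fintype ι'] [DecidableEq ι] [DecidableEq ι'] in
/-- `D` = cross + uncross. -/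
theorem cross_add_uncross (D : Matrix ι ι' K) :
    (Matrix.of fun x y => if lastR row x ≠ lastC col y then D x y else 0) + uncross row col D = D := by
  ext x y
  simp only [Matrix.add_apply, Matrix.of_apply, uncross_apply]
  by_cases h : lastR row x = lastC col y <;> simp [h]

omit [Fintype ι] [Fintype ι'] [DecidableEq ι] [DecidableEq ι'] in
/-- Masks commute with un-crossing. -/
theorem maskJ_uncross (B' : Finset (Fin (n' + 1) → Bool)) (D : Matrix ι ι' K) :
    maskJ row col B' (uncross row col D) = Matrix.of fun x y => if lastR row x = lastC col y then maskJ row col B' D x y else 0 := by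
  ext x y
  simp only [maskJ, Matrix.of_apply, uncross_apply]
  split_ifs <;> rfl

/-- A first-family block of a "same last bit" pattern splits into its two halves, so its rank at most doubles. -/
theorem rank_sameLast_block_le (M : Matrix ι ι' K) (P : ι → Prop) (P' : ι' → Prop) [DecidablePred P] [DecidablePred P'] :
    (Matrix.of fun x y => if P x ∧ P' y then
        (Matrix.of fun x y => if lastR row x = lastC col y then M x y else (0 : K)) x y else 0).rank ≤
      2 * (Matrix.of fun x y => if P x ∧ P' y then M x y else 0).rank := by
  set A : Matrix ι ι' K := Matrix.of fun x y => if P x ∧ P' y then M x y else 0 with hA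
  have e : (Matrix.of fun x y => if P x ∧ P' y then
        (Matrix.of fun x y => if lastR row x = lastC col y then M x y else (0 : K)) x y else 0) =
      (Matrix.of fun x y => if lastR row x = false ∧ lastC col y = false then A x y else 0) +
      (Matrix.of fun x y => if lastR row x = true ∧ lastC col y = true then A x y else 0) := by
    ext x y
    simp only [hA, Matrix.of_apply, Matrix.add_apply, lastR, lastC]
    rcases Bool.eq_false_or_eq_true (row x (Sum.inr (Fin.last n'))) with h1 | h1 <;>
      rcases Bool.eq_false_or_eq_true (col y (Sum.inr (Fin.last n'))) with h2 | h2 <;>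
      by_cases h3 : P x <;> by_cases h4 : P' y <;> simp [h1, h2, h3, h4]
  rw [e, two_mul]
  exact (rank_add_le' _ _).trans (Nat.add_le_add (rank_mask_le _ _ A) (rank_mask_le _ _ A))

/-- **Un-crossing at most doubles the double cuts.** -/
theorem doubleCut_uncross_le (D : Matrix ι ι' K) (B : Finset (Fin n → Bool)) (B' : Finset (Fin (n' + 1) → Bool)) :
    doubleCut row col B B' (uncross row col D) ≤ 2 * doubleCut row col B B' D := by
  unfold doubleCut
  rw [maskJ_uncross, Nat.mul_add]
  exact Nat.add_le_add (rank_sameLast_block_le row col _ _ _) (rank_sameLast_block_le row col _ _ _)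

/-! ### The two halves as instances with `n'` second-family coordinates -/

/-- Row colouring of the half-instance: drop the last second-family coordinate. -/
def rowHalf (b : Bool) (x : {x : ι // lastR row x = b}) : Fin n ⊕ Fin n' → Bool :=
  fun s => Sum.elim (fun k => row x.1 (Sum.inl k)) (fun k' => row x.1 (Sum.inr (Fin.castSucc k'))) s

/-- Column colouring of the half-instance: drop the last second-family coordinate. -/
def colHalf (b : Bool) (y : {y : ι' // lastC col y = b}) : Fin n ⊕ Fin n' → Bool :=
  fun s => Sum.elim (fun k => col y.1 (Sum.inl k)) (fun k' => col y.1 (Sum.inr (Fin.castSucc k'))) s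

/-- Lift of a set of truncated second-family colours to the full colours. -/
def liftJ (B' : Finset (Fin n' → Bool)) : Finset (Fin (n' + 1) → Bool) :=
  Finset.univ.filter fun σ => (fun k' => σ (Fin.castSucc k')) ∈ B'

omit [Fintype ι] [Fintype ι'] [DecidableEq ι] [DecidableEq ι'] in
/-- The half-instance keeps the first-family colours of its rows. -/
theorem colourI_rowHalf (b : Bool) (x : {x : ι // lastR row x = b}) : colourI (rowHalf row b x) = colourI (row x.1) := by
  funext k; rfl

omit [Fintype ι] [Fintype ι'] [DecidableEq ι] [DecidableEq ι'] in
/-- The half-instance keeps the first-family colours of its columns. -/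
theorem colourI_colHalf (b : Bool) (y : {y : ι' // lastC col y = b}) : colourI (colHalf col b y) = colourI (col y.1) := by
  funext k; rfl

omit [Fintype ι] [Fintype ι'] [DecidableEq ι] [DecidableEq ι'] in
/-- Truncated second-family row colours lie in `B'` iff the full colours lie in the lift of `B'`. -/
theorem colourJ_rowHalf_mem (b : Bool) (x : {x : ι // lastR row x = b}) (B' : Finset (Fin n' → Bool)) :
    colourJ (rowHalf row b x) ∈ B' ↔ colourJ (row x.1) ∈ liftJ B' := by
  simp only [liftJ, Finset.mem_filter, Finset.mem_univ, true_and]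
  exact Iff.rfl

omit [Fintype ι] [Fintype ι'] [DecidableEq ι] [DecidableEq ι'] in
/-- Truncated second-family column colours lie in `B'` iff the full colours lie in the lift of `B'`. -/
theorem colourJ_colHalf_mem (b : Bool) (y : {y : ι' // lastC col y = b}) (B' : Finset (Fin n' → Bool)) :
    colourJ (colHalf col b y) ∈ B' ↔ colourJ (col y.1) ∈ liftJ B' := by
  simp only [liftJ, Finset.mem_filter, Finset.mem_univ, true_and]
  exact Iff.rfl

omit [Fintype ι] [Fintype ι'] [DecidableEq ι] [DecidableEq ι'] in
/-- The mask of the half-instance is the restriction of the lifted mask. -/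
theorem maskJ_half (b : Bool) (B' : Finset (Fin n' → Bool)) (D : Matrix ι ι' K) :
    maskJ (rowHalf row b) (colHalf col b) B' (D.submatrix Subtype.val Subtype.val) =
      (maskJ row col (liftJ B') D).submatrix Subtype.val Subtype.val := by
  ext x y
  simp only [maskJ, Matrix.of_apply, Matrix.submatrix_apply]
  by_cases h1 : colourJ (row x.1) ∈ liftJ B' <;> by_cases h2 : colourJ (col y.1) ∈ liftJ B' <;>
    simp [h1, h2, colourJ_rowHalf_mem row b x B', colourJ_colHalf_mem col b y B']

omit [Fintype ι] [DecidableEq ι] [DecidableEq ι'] in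
/-- **The double cuts of a half are sub-blocks of the double cuts of the whole.** -/
theorem doubleCut_half_le (b : Bool) (D : Matrix ι ι' K) (B : Finset (Fin n → Bool)) (B' : Finset (Fin n' → Bool)) :
    doubleCut (rowHalf row b) (colHalf col b) B B' (D.submatrix Subtype.val Subtype.val) ≤
      doubleCut row col B (liftJ B') D := by
  unfold doubleCut
  rw [maskJ_half]
  refine Nat.add_le_add ?_ ?_
  · have e : (Matrix.of fun (x : {x : ι // lastR row x = b}) (y : {y : ι' // lastC col y = b}) =>
        if colourI (rowHalf row b x) ∈ B ∧ colourI (colHalf col b y) ∉ B then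
          (maskJ row col (liftJ B') D).submatrix Subtype.val Subtype.val x y else 0) =
        (Matrix.of fun x y => if colourI (row x) ∈ B ∧ colourI (col y) ∉ B then maskJ row col (liftJ B') D x y else 0).submatrix
          Subtype.val Subtype.val := by
      ext x y
      simp only [Matrix.of_apply, Matrix.submatrix_apply, colourI_rowHalf, colourI_colHalf]
    rw [e]
    exact Matrix.rank_submatrix_le _ _ _
  · have e : (Matrix.of fun (x : {x : ι // lastR row x = b}) (y : {y : ι' // lastC col y = b}) =>
        if colourI (rowHalf row b x) ∉ B ∧ colourI (colHalf col b y) ∈ B then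
          (maskJ row col (liftJ B') D).submatrix Subtype.val Subtype.val x y else 0) =
        (Matrix.of fun x y => if colourI (row x) ∉ B ∧ colourI (col y) ∈ B then maskJ row col (liftJ B') D x y else 0).submatrix
          Subtype.val Subtype.val := by
      ext x y
      simp only [Matrix.of_apply, Matrix.submatrix_apply, colourI_rowHalf, colourI_colHalf]
    rw [e]
    exact Matrix.rank_submatrix_le _ _ _

omit [Fintype ι] [Fintype ι'] [DecidableEq ι] [DecidableEq ι'] in
/-- Inside a half, a differing second-family coordinate is not the last one. -/
theorem exists_castSucc_ne {b : Bool} {x : ι} {y : ι'} (hx : lastR row x = b) (hy : lastC col y = b)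
    (h : ∃ k', row x (Sum.inr k') ≠ col y (Sum.inr k')) :
    ∃ k'' : Fin n', row x (Sum.inr (Fin.castSucc k'')) ≠ col y (Sum.inr (Fin.castSucc k'')) := by
  obtain ⟨k', hk'⟩ := h
  induction k' using Fin.lastCases with
  | last => exact absurd (hx.trans hy.symm) hk'
  | cast k'' => exact ⟨k'', hk'⟩

/-- **Zero-extension of a half decomposition**: from `S_I, S_J, L` on the half `{last bit = b}` a matrix on the whole index set of
no larger rank which agrees with `D` on the visible cells of that half. -/
theorem exists_halfCompletion (b : Bool) (D : Matrix ι ι' K) (m : ℕ)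
    (SI SJ : Matrix {x : ι // lastR row x = b} {y : ι' // lastC col y = b} K)
    (hSI : ∀ x y, (∃ k, rowHalf row b x (Sum.inl k) ≠ colHalf col b y (Sum.inl k)) → SI x y = 0)
    (hSJ : ∀ x y, (∃ k', rowHalf row b x (Sum.inr k') ≠ colHalf col b y (Sum.inr k')) → SJ x y = 0)
    (hL : (D.submatrix Subtype.val Subtype.val - SI - SJ).rank ≤ m) :
    ∃ L : Matrix ι ι' K, L.rank ≤ m ∧
      ∀ x y, lastR row x = b → lastC col y = b →
        (∃ k, row x (Sum.inl k) ≠ col y (Sum.inl k)) → (∃ k', row x (Sum.inr k') ≠ col y (Sum.inr k')) →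
        L x y = D x y := by
  set X : Matrix {x : ι // lastR row x = b} {y : ι' // lastC col y = b} K := D.submatrix Subtype.val Subtype.val - SI - SJ with hX
  refine ⟨Matrix.of fun x y => if hx : lastR row x = b then (if hy : lastC col y = b then X ⟨x, hx⟩ ⟨y, hy⟩ else 0) else 0,
    (rank_pad_le _ _ X).trans hL, ?_⟩
  intro x y hx hy hI hJ
  have h1 : SI ⟨x, hx⟩ ⟨y, hy⟩ = 0 := hSI _ _ (by obtain ⟨k, hk⟩ := hI; exact ⟨k, hk⟩)
  have h2 : SJ ⟨x, hx⟩ ⟨y, hy⟩ = 0 :=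
    hSJ _ _ (by obtain ⟨k'', hk''⟩ := exists_castSucc_ne row col hx hy hJ; exact ⟨k'', hk''⟩)
  simp only [Matrix.of_apply, dif_pos hx, dif_pos hy, hX, Matrix.sub_apply, Matrix.submatrix_apply, h1, h2, sub_zero]

end Tools

/-! ## The reduction -/

/-- **MERGE ⟹ the 2D max-cut decomposition with a constant LINEAR in the number of second-family coordinates** (levels `≤ n'`;
the MERGE bound is only needed below level `n'`). -/
theorem doubleMaxCut_of_merge_le {n n' lam : ℕ} (hM : ∀ n'', n'' < n' → MergeBound K n n'' lam) :
    ∀ n'', n'' ≤ n' → DoubleMaxCutDecomposition K n n'' ((4 + 2 * lam) * n'') := by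
  intro n''
  induction n'' with
  | zero =>
      intro _ ι ι' _ _ _ _ row col D c hc
      refine ⟨0, D, fun _ _ _ => rfl, ?_, by simp⟩
      rintro x y ⟨k', -⟩
      exact k'.elim0
  | succ n'' ih =>
      intro hle ι ι' _ _ _ _ row col D c hc
      classical
      have ih' := ih (Nat.le_of_succ_le hle)
      -- (1) the cross matrix is within `4c` of a first-family block-diagonal matrix
      set X : Matrix ι ι' K := Matrix.of fun x y => if lastR row x ≠ lastC col y then D x y else 0 with hXdef
      obtain ⟨R', hR', hXR'⟩ := exists_blockDiagonal_of_cuts_le (fun x => colourI (row x)) (fun y => colourI (col y)) X c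
        (cross_cuts_le row col D c hc)
      -- (2) the un-crossed matrix and its halves
      set N : Matrix ι ι' K := uncross row col D with hNdef
      have hNc : ∀ B B', doubleCut row col B B' N ≤ 2 * c := fun B B' =>
        (doubleCut_uncross_le row col D B B').trans (Nat.mul_le_mul_left 2 (hc B B'))
      have hNcross : ∀ x y, row x (Sum.inr (Fin.last n'')) ≠ col y (Sum.inr (Fin.last n'')) → N x y = 0 := by
        intro x y h
        rw [hNdef, uncross_apply, if_neg h]
      have hhalf : ∀ b : Bool, ∃ L : Matrix ι ι' K, L.rank ≤ (4 + 2 * lam) * n'' * c ∧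
          ∀ x y, row x (Sum.inr (Fin.last n'')) = b → col y (Sum.inr (Fin.last n'')) = b →
            (∃ k, row x (Sum.inl k) ≠ col y (Sum.inl k)) → (∃ k', row x (Sum.inr k') ≠ col y (Sum.inr k')) →
            L x y = N x y := by
        intro b
        have hcb : ∀ B B', doubleCut (rowHalf row b) (colHalf col b) B B' (D.submatrix Subtype.val Subtype.val) ≤ c :=
          fun B B' => (doubleCut_half_le row col b D B B').trans (hc B (liftJ B'))
        obtain ⟨SI, SJ, hSI, hSJ, hL⟩ :=
          ih' {x : ι // lastR row x = b} {y : ι' // lastC col y = b} (rowHalf row b) (colHalf col b)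
            (D.submatrix Subtype.val Subtype.val) c hcb
        obtain ⟨L, hLr, hLD⟩ := exists_halfCompletion row col b D _ SI SJ hSI hSJ hL
        refine ⟨L, hLr, fun x y hx hy hI hJ => ?_⟩
        rw [hLD x y hx hy hI hJ, hNdef, uncross_apply, if_pos (hx.trans hy.symm)]
      -- (3) MERGE
      obtain ⟨SI, SJ, hSI, hSJ, hL⟩ :=
        hM n'' (Nat.lt_of_succ_le hle) ι ι' row col N (2 * c) ((4 + 2 * lam) * n'' * c) hNc hNcross hhalf
      refine ⟨SI + R', SJ, ?_, hSJ, ?_⟩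
      · rintro x y ⟨k, hk⟩
        have hne : colourI (row x) ≠ colourI (col y) := fun h => hk (congrFun h k)
        rw [Matrix.add_apply, hSI x y ⟨k, hk⟩, hR' x y hne, add_zero]
      · have e : D - (SI + R') - SJ = (N - SI - SJ) + (X - R') := by
          rw [← cross_add_uncross row col D]; abel
        rw [e]
        calc ((N - SI - SJ) + (X - R')).rank ≤ (N - SI - SJ).rank + (X - R').rank := rank_add_le' _ _
          _ ≤ ((4 + 2 * lam) * n'' * c + lam * (2 * c)) + 4 * c := Nat.add_le_add hL hXR'
          _ = (4 + 2 * lam) * (n'' + 1) * c := by ring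

/-- **MERGE ⟹ the 2D max-cut decomposition with a constant LINEAR in the number of second-family coordinates.** -/
theorem doubleMaxCut_of_merge {n lam : ℕ} (hM : ∀ n', MergeBound K n n' lam) (n' : ℕ) :
    DoubleMaxCutDecomposition K n n' ((4 + 2 * lam) * n') :=
  doubleMaxCut_of_merge_le (fun n'' _ => hM n'') n' le_rfl

/-- **The registered form from a polynomial MERGE bound**: if MERGE holds over every field with `λ₁ = L₁ (n+n'+2)^e` (polynomial in
the number `n + (n'+1)` of coordinates of the merged instance) then the 2D max-cut decomposition holds with `λ = (4 + 2 L₁) (n+n'+1)^{e+1}`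
— the conclusion of `stub_doubleMaxCutDecomposition`. -/
theorem doubleMaxCutDecomposition_poly_of_merge {L₁ e : ℕ}
    (hM : ∀ (K : Type) [Field K] (n n' : ℕ), MergeBound K n n' (L₁ * (n + n' + 2) ^ e)) :
    ∃ L e' : ℕ, ∀ (K : Type) [Field K] (n n' : ℕ), DoubleMaxCutDecomposition K n n' (L * (n + n' + 1) ^ e') := by
  refine ⟨4 + 2 * L₁, e + 1, fun K _ n n' => ?_⟩
  -- below level `n'` the MERGE constants are dominated by the level-independent `lam := L₁ (n + n' + 1)^e`
  have hM' : ∀ n'', n'' < n' → MergeBound K n n'' (L₁ * (n + n' + 1) ^ e) := by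
    intro n'' hn'' ι ι' _ _ _ _ row col D c m hc hcross hhalf
    obtain ⟨SI, SJ, h1, h2, h3⟩ := hM K n n'' ι ι' row col D c m hc hcross hhalf
    refine ⟨SI, SJ, h1, h2, h3.trans (Nat.add_le_add_left (Nat.mul_le_mul_right c ?_) m)⟩
    exact Nat.mul_le_mul_left L₁ (Nat.pow_le_pow_left (by omega) e)
  refine doubleMaxCutDecomposition_mono (doubleMaxCut_of_merge_le hM' n' le_rfl) ?_
  calc (4 + 2 * (L₁ * (n + n' + 1) ^ e)) * n'
      ≤ (4 * (n + n' + 1) ^ e + 2 * (L₁ * (n + n' + 1) ^ e)) * (n + n' + 1) := by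
        apply Nat.mul_le_mul _ (by omega)
        apply Nat.add_le_add_right
        exact Nat.le_mul_of_pos_right 4 (pow_pos (by omega) e)
    _ = (4 + 2 * L₁) * (n + n' + 1) ^ (e + 1) := by ring

end Summit.PneNP.PneNP.Theorems.CnfIdealGenLengthRankDefectRepresentationsMergeReduction
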